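import Mathlib
import HarnessLib
import HarnessLib.Audit
import Summits.SmoothPoincare4.Statement
import Literature.Topology.FourManifolds.AchiralLefschetzFibration
import Literature.AlgebraicTopology.SingularHomology.SingularChains
import HarnessLib.Audit.Status.Attr

/-!
Route: SblfDescent

DORMANT since 2026-08-26T13:39:48Z (reconciler: no traction for 6.7 d (last activity item-evidence-added at 2026-08-19T19:16:16Z); parked, not closed — `ledger route dormant route-SmoothPoincare4-SblfDescent --off` to reactivate) — unstaffed, not closed; items shared with open routes are served there. `ledger route dormant <id> --off` reactivates.

# Route SblfDescent — broken-genus descent — every simplified broken Lefschetz fibration on a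
homotopy 4-sphere destabilises; genus 1 is Hayano's theorem

LENS strengthen-to-induct (S⁺ = a graded statement proved by descent; induction variable = the genus
of a simplified broken Lefschetz
fibration, SBLF). Present a smooth homotopy 4-sphere M by an SBLF f : M → S² (one indefinite fold
circle with embedded image, positive
Lefschetz points all on the higher-genus side, connected fibres of genus h+1 / h; such f exist on
every closed oriented 4-manifold —
Baykur, Lekili, Akbulut–Karakurt, Williams, Baykur–Saeki — and on a homotopy sphere the round locus
is non-empty). Write HAS(M,h) for
"M admits an SBLF of lower genus h" (spelled out inline in every item over the tree's LefschetzChart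
/ SmoothOrientation and an explicit
indefinite fold chart; genus read as rank H₁ of the regular fibres). It suffices to show X = StepTwo
∧ StepGE3: (StepTwo) HAS(M,1) →
HAS(M,0) and (StepGE3) ∀ h ≥ 1, HAS(M,h+1) → HAS(M,h), for every M ≃ₕ S⁴. With the supports
SblfExists (∃ h, HAS(M,h)) and RungOne
(HAS(M,0) → M ≅ S⁴: Hayano's / Baykur–Kamada's classification of genus-1 SBLFs) the deciding theorem
is an ℕ-induction on h (glue.lean,
kernel-checked). Realises card sblf-starvation-ladder (spine; its STARVE conjecture is the inductive
step); X ⇔ SPC4 given the two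
supports (S⁴ carries SBLFs of every genus), so no slack is claimed: the content is the descent
METHOD — the Euler budget forces exactly
4g−4 Lefschetz points at genus g, and the new lemma MEETS (CANDIDATE-SblfDescent.md §D: some
vanishing cycle meets the round curve;
proved for genus ≤ 3, for all genera modulo a Lefschetz-fibred exotic S²×S²) is the first tooth of
un-flip-and-slip recognition.
Lean: `StepTwo ∧ StepGE3`

## Assembly
Pure logic, an ℕ-induction on the lower genus h (glue.lean `closes`, kernel-checked rc 0 in
Sketch.lean, 2026-08-17): given M and
e : M ≃ₕ S⁴, SblfExists gives h with HAS(M,h); `key : ∀ h, HAS(M,h) → Nonempty (M ≃ₘ S⁴)` by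
induction — h = 0 is RungOne, h = 1
reduces to h = 0 by StepTwo, h+2 reduces to h+1 by StepGE3 — and `key h` closes. `SmoothPoincare4`
unfolds to exactly the items'
binder shape (M : Type, T2, second countable, C^∞ atlas on ℝ⁴, M ≃ₕ S⁴), so no compactness /
orientability packaging enters.

Rationale: WHY THIS LINE. Mechanism: Baykur–Hayano's correspondence (arXiv:1410.5531 Thm 1.1) turns an SBLF
into a Hurwitz cycle system (c; c₁,…,c_k) on Σ_g
with μ = t_{c_k}⋯t_{c₁} fixing c and capping to the identity, and a homotopy sphere forces k = 4g −
4 (χ = 6 − 4g + k, Baykur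
arXiv:1205.5439): a POSITIVE factorisation on a starvation budget, one flip-and-slip (g, k) ↦ (g+1,
k+4) above the previous rung. The
bottom rung is a theorem (genus-1 SBLFs classified: Hayano arXiv:1012.4049 + Hiroshima MJ 2014,
Baykur–Kamada arXiv:1010.5814 Thm 13;
only S⁴ among homotopy spheres), so SPC4 becomes "homotopy-sphere systems destabilise", and the
first obstruction to destabilisation —
a system all of whose vanishing cycles avoid the round curve — is excluded by Lefschetz-fibration
geography of the CAPPED fibration Y
(Stipsicz MRL 1999 / Ozbagci signature bounds, Matsumoto's ℤ/10 count, Seiberg–Witten at b⁺(Y) = 1 —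
gauge theory applied to Y, never
to Σ) for g ≤ 3 and, for all g, modulo the Kervaire conjecture for π₁(Y) and the non-existence of
Lefschetz-fibred exotic S²×S²'s.
Imported areas: mapping class groups and positive Dehn-twist factorisations (contact/symplectic
monodromy), symplectic geography of
Lefschetz fibrations, singularity theory of stable maps to surfaces. What no listed route does: none
uses maps to S², broken fibrations
or Dehn-twist factorisations; GroupTrisection / CongruenceShadows grade by trisection genus with no
positivity and no forced length
(Baykur–Saeki's dictionary makes the gradings transverse); the negatives index is empty.

RANKED CRUXES. #2 StepGE3 (crux) — descent above genus 2 — for every smooth M ≃ₕ S⁴ and every h ≥ 1,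
if M admits a simplified broken Lefschetz fibration of lower genus h+1 (genus h+2, necessarily with
4h+4 positive Lefschetz points) then it admits one of lower genus h (card sblf-starvation-ladder:
STARVE(g), g ≥ 3, in geometric form). [difficulty: open-problem] (why it might fail: shielded
(SPC4-implied); the engine fails if a Hurwitz-rigid homotopy-sphere system exists at genus ≥ 3
(destabilisation only after stabilising = Williams' move-completeness = SPC4 verbatim), or if a
Lefschetz-fibred exotic S²×S² populates the all-disjoint sector beyond genus 3.) [arXiv:1410.5531,
arXiv:1205.5439, arXiv:1203.4299, arXiv:1110.0161, doi:10.4310/mrl.1999.v6.n4.a7]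
#3 StepTwo (crux) — the finite rung — for every smooth M ≃ₕ S⁴, a simplified broken Lefschetz
fibration of lower genus 1 (genus 2, exactly four Lefschetz points, some vanishing cycle meeting the
round curve by MEETS(2)) can be traded for one of lower genus 0 (genus 1); via Birman–Hilden a
bounded problem about products of four positive half-twists in Map(S², 6 points) (card rung 2).
[difficulty: L] (why it might fail: shielded; a genus-2 Hurwitz system of an exotic sphere would be
¬SPC4; the B₆ enumeration may be infinite up to Hurwitz equivalence and Stab(c)-conjugation, or a
genus-2 classification in print may make the rung known (then variant, start at genus 3).)
[arXiv:1012.4049, arXiv:1010.5814, arXiv:1410.5531, arXiv:1203.4299]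
#9 SblfExists (support) — every smooth M ≃ₕ S⁴ admits a simplified broken Lefschetz fibration with
non-empty round locus, of some lower genus h (existence of SBLFs on all closed oriented 4-manifolds:
Baykur 2008, Lekili, Akbulut–Karakurt, Williams, Baykur–Saeki; an honest Lefschetz fibration over S²
has b₂ ≥ 1, so on a homotopy sphere the round locus is non-empty). Published theorems; long
formalisation. [difficulty: XL] [arXiv:0801.3139, arXiv:0712.2202, arXiv:0803.2297,
arXiv:1705.11169]
#9 RungOne (support) — the genus-1 rung — a smooth M ≃ₕ S⁴ with a simplified broken Lefschetz
fibration of lower genus 0 (genus 1, round locus non-empty) is diffeomorphic to S⁴ (Hayano's and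
Baykur–Kamada's classification of genus-1 SBLFs: total spaces S⁴, #CP²'s and CP²bar's, S¹×S³ # …,
Pao's L_n, L′_n; the only homotopy sphere is S⁴, Baykur arXiv:1205.5439 p.18). Published theorem;
long formalisation. [difficulty: XL] [arXiv:1012.4049, arXiv:1010.5814, arXiv:1205.5439]

TWO-LAYER PLAN. Foreseen glued splits (nothing filed now): StepGE3 ⇐ MeetsRoundCurve →
UnflipRecognition → StepGE3 (MEETS(g): some vanishing cycle of a
homotopy-sphere system meets the round curve — CANDIDATE §D, theorem for g ≤ 3; UnflipRecognition: a
system with a cycle meeting c once in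
Hayano's R₂ pattern destabilises — arXiv:1203.4299); StepTwo ⇐ GenusTwoBraidCensus →
KirbyVerification → StepTwo (the B₆ enumeration of
§E of the dossier, then Baykur's handle diagrams). The algebraic layer (Hurwitz cycle systems over
the tree's SurfaceGroup / Dehn–Nielsen–
Baer files, the capping map Φ_c) is a definition request; once it lands, STARVE-ALG / MEETS-ALG /
RUNG2-ALG become typed children.

KILL CRITERIA. An exotic S⁴ with an SBLF of genus 2 (resp. ≥ 3) refutes StepTwo (resp. StepGE3) and
SPC4 at once — close `refuted:<Decl>`. A genus-2
SBLF classification in print covering homotopy spheres makes StepTwo `known`: drop it to support and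
re-rank (route survives on StepGE3 +
the genus-3 rung). A Hurwitz-rigid S⁴-system (not Hurwitz+conjugation-equivalent to a flip-and-slip
pattern) kills the starvation ENGINE
(the typed cruxes survive but lose their method): pivot to the weaker "stabilise once, then
destabilise twice" form or retire `exhausted`.
A Lefschetz-fibred exotic S²×S² / CP²#CP²bar voids MEETS beyond genus 3 (pivot: MEETS from the
Kervaire conjecture alone). SPC4 proved
elsewhere moots the route; GroupTrisection's AgkCor6 programme closing does NOT (transverse
grading).

NOT DECOMPOSED YET. The algebraic layer (Hurwitz systems, Φ_c, flip-and-slip as an operation on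
systems) and with it MEETS / UnflipRecognition / the B₆ census
as items; the Euler count L.card = 4h+4 (stub_count of the birth skeletons; an M-sized formalisation
of χ-additivity over the three pieces
of an SBLF); relative minimality (vacuous on homotopy spheres, H₂ = 0); the genus-3 rung as a
separate item (first non-hyperelliptic case,
Hayano–Sato arXiv:1110.0161 Thm 1.1(ii)); any use of Williams' move-completeness (it would make the
route a costume).

CHEAPEST FALSIFIER. (1) Literature lookup: a classification of genus-2 simplified broken Lefschetz
fibrations (Hayano 2012–2016, Baykur–Hayano, Behrens–Hayano)
that already lists the homotopy-sphere systems — ran `lit search --hybrid` (no hit), read Baykur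
arXiv:1205.5439 (Problem 24 is the
genus-1 question; §5 remark "if this difference were constant … no exotic S⁴s") and Baykur–Hayano
arXiv:1410.5531 (Thm 1.1, g ≥ 3; no
genus-2 homotopy-sphere list); remote APIs (OpenAlex/arXiv/S2) rate-limited this session — NOT
settled, refuters first. (2) The all-disjoint
sector (cheapest structural attack on STARVE): settled on paper this cycle for g ≤ 3 (MEETS,
CANDIDATE §D) — it is EMPTY, by 12 ∤ 4 in
SL(2,ℤ)^ab and by Map(Σ₂)^ab = ℤ/10 ((n,s) = (8,0) violates n + 2s ≡ 0 mod 10). (3) kit job (not yet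
run): enumerate length-4 positive
words in the band generators of B₆ satisfying the two closing conditions of §E up to Hurwitz moves —
finiteness and the flip-and-slip
normal form are both checkable.

NUMBERS. k = 4g − 4 Lefschetz points at genus g (χ = 6 − 4g + k = 2); Baykur's handle count 2g
one-handles, k + 3 two-handles; genus-1 Lefschetz
fibrations over S² have 12m singular fibres; Map(Σ₂)^ab = ℤ/10 (n + 2s ≡ 0 mod 10), Matsumoto σ =
−(3n + s)/5; Stipsicz: n ≥ (4h+2)/5,
Ozbagci–Cadavid σ ≤ n − s − 2(2h − b₁); capped fibration Y of an all-disjoint system: χ(Y) = 4, b₂ =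
2, σ = 0, H₁ = 0. Items at open: 5.

DEFINITION REQUESTS. (after open) `HurwitzCycleSystem g` over `Literature.Topology.FourManifolds`
Dehn–Nielsen–Baer infrastructure (Map(Σ_g) = Out⁺(S_g), Dehn
twists as conjugates of the standard transvection, the capping map Φ_c : Map(Σ_g)_c → Map(Σ_{g−1}),
Hurwitz equivalence, flip-and-slip
on systems); cite facts wanted: Baykur–Hayano Thm 1.1 (arXiv:1410.5531), Hayano genus-1
classification (arXiv:1012.4049 Main Thm B;
Hiroshima MJ 44 (2014)), Baykur–Kamada Thm 13 (arXiv:1010.5814), existence of SBLFs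
(arXiv:0801.3139, arXiv:1705.11169), Baykur's Euler /
handle lemma (arXiv:1205.5439 p.8), Hayano's R₂-move rule (arXiv:1203.4299), Stipsicz MRL 1999 Thm
1.1 / Rem 2.8(b)
(doi:10.4310/mrl.1999.v6.n4.a7), Hayano–Sato Thm 1.1(ii) (arXiv:1110.0161).

Novelty: Searches (2026-08-17): `lit search --hybrid "simplified broken Lefschetz fibration genus homotopy
4-sphere flip and slip"` (12 generic hits,
none on SBLFs); `lit read arxiv:1205.5439 --grep genus|exotic|Problem|sphere` (85 lines: Thm 18, §5
remark, Problems 24–28 read);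
`lit read arxiv:1410.5531` (Thm 1.1, Hurwitz cycle systems, g ≥ 3); `lit read
doi:10.4310/mrl.1999.v6.n4.a7` (Stipsicz Thms 1.1/1.3/1.5,
Ozbagci's Thm 2.6 and the Cadavid refinement); `lit search --source zbmath "Stipsicz Lefschetz
fibration singular fibers"` (6); OpenAlex /
arXiv / S2 429-limited; current_theses.json (54 routes: no
Lefschetz/broken/Morse-2-function/induction item); Ideas index (42 + closed:
sblf-starvation-ladder open/variant, sblf-nonhyperelliptic-ladder superseded); BC4 `exact?` against
Mathlib + 59 theses: no match.
Nearest prior art found: card sblf-starvation-ladder (this summit, 2026-08-15, graded variant: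
ladder printed in Baykur arXiv:1205.5439
Thm 18 / p.19 / Problem 24 and Hayano arXiv:1012.4049; STARVE flagged as the would-be new element);
Baykur–Hayano arXiv:1410.5531 Thm 1.1
(the dictionary); nearest ROUTE GroupTrisection (AGK stably-trivial group trisections).
Delta: the descent step is typed and made load-bearing in a kernel-checked ℕ-induction to
SmoothPoincare4, and its first obstruction (systems
avoiding the round curve) is removed by Lefschetz-fibration geography of the capped fibration —
genus ≤ 3 unconditionally, all genera modulo
Kervaire + "no Lefschetz-fibred exotic S²  [refs: 10.4310/mrl.1999.v6.n4.a7`, 1205.5439, 1410.5531, 1012.4049, arxiv:1205.5439, arxiv:1410.5531, doi:10.4310/mrl.1999.v6.n4.a7]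

Barriers (technique_class: sblf-genus-descent, positive-factorisation): - technique_class: sblf-genus-descent, positive-factorisation
- Literature.Barriers.SmoothPoincare4.LowGenusTrisectionBarrier: transverse grading — an SBLF of
genus g with 4g−4 Lefschetz points maps (Baykur–Saeki) to a trisection of genus ≈ 5g, so rung 2 here
is trisection genus ≈ 10, outside (3;1,1,1); neither low rung implies the other (the companion
LargeKTrisectionBarrier of the same file likewise); not evaded, not applicable.
- Literature.Barriers.SmoothPoincare4.StrictPropertyTwoRBarrier: Hurwitz equivalence of positive
factorisations is not strict handle-sliding of an R-link and no Andrews–Curtis class is preserved by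
flip-and-slip; honest point of contact: a Hurwitz-RIGID S⁴-system would be the analogue of an
AC-rigid presentation (kill criterion), flagged not evaded.
- Literature.Barriers.SmoothPoincare4.TwistedSphereBarrierFour: no step presents Σ as D⁴ ∪_φ D⁴;
recognition at the bottom rung is Hayano/Baykur–Kamada's explicit classification.
- Literature.Barriers.SmoothPoincare4.HCobordismBarrierFour: no h-cobordism ⇒ diffeomorphism
inference anywhere; the induction lives on one manifold M.
- Literature.Barriers.SmoothPoincare4.GaugeSumBarrierFour: evaded — Seiberg–Witten / Taubes–Liu
enter only through the geography of the auxiliary closed-up Lefschetz fibration Y (b⁺(Y) = 1, Y not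
a homotopy sphere), never as an invariant of Σ or of Σ # Y.
- Literature.Barriers.SmoothPoincare4.TopologicalBarrierFour: nothing is detected; the route proves
diffeomorphism by descent

History (route lifecycle, newest last):
- 2026-08-26T13:39:48Z · DORMANT — reconciler: no traction for 6.7 d (last activity item-evidence-added at 2026-08-19T19:16:16Z); parked, not closed — `ledger route dormant route-SmoothPoincare4- (operator:999:3189239)

sub-problem: SmoothPoincare4 · status: dormant · opened planner-plan-lens3-SmoothPoincare4-strengthen-0 2026-08-17T02:42:15Z · rev 2 · ledger route-SmoothPoincare4-SblfDescent
GENERATED by the gate from the ledger (D-0016/17). Provers cite these decls: `theorem foo : Summit.SmoothPoincare4.SmoothPoincare4.Theses.SblfDescent.<Decl> := …` in Summits/SmoothPoincare4/SmoothPoincare4/Theorems/<Name>.lean.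
-/

namespace Summit.SmoothPoincare4.SmoothPoincare4.Theses.SblfDescent

open scoped BigOperators Topology Manifold Classical MeasureTheory ProbabilityTheory Matrix InnerProductSpace ComplexConjugate ContinuousMap
open Filter Set Function TopologicalSpace MeasureTheory

attribute [summit_statement] _root_.SmoothPoincare4

open Literature.SPC4

/-- item stmt-SmoothPoincare4-18528 · crux · rank 2 · open · by planner
why it might fail: shielded (SPC4-implied); the engine fails if a Hurwitz-rigid homotopy-sphere system exists at genus ≥ 3 (destabilisation only after stabilising = Williams' move-completeness = SPC4 verbatim), or if a Lefschetz-fibred exotic S²×S² populates the all-disjoint sector beyond genus 3.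
sources: arXiv:1410.5531, arXiv:1205.5439, arXiv:1203.4299, arXiv:1110.0161, doi:10.4310/mrl.1999.v6.n4.a7
[crux] descent above genus 2 — for every smooth M ≃ₕ S⁴ and every h ≥ 1, if M admits a simplified
broken Lefschetz fibration of lower genus h+1 (genus h+2, necessarily with 4h+4 positive Lefschetz
points) then it admits one of lower genus h (card sblf-starvation-ladder: STARVE(g), g ≥ 3, in
geometric form). [difficulty: open-problem] -/
@[route_item "route-SmoothPoincare4-SblfDescent", crux]
def StepGE3 : Prop :=
  ∀ (M : Type) [TopologicalSpace M] [T2Space M] [SecondCountableTopology M] [ChartedSpace (EuclideanSpace ℝ (Fin 4)) M] [IsManifold (𝓡 4) ((⊤ : ℕ∞) : WithTop ℕ∞) M], M ≃ₕ (Metric.sphere (0 : EuclideanSpace ℝ (Fin 5)) 1) → ∀ h : ℕ, 1 ≤ h → (∃ (o : Literature.Topology.FourManifolds.SmoothOrientation (𝓡 4) M) (f : M → (Metric.sphere (0 : EuclideanSpace ℝ (Fin 3)) 1)) (L : Finset M), let R : M → Prop := fun q => Function.Surjective (mfderiv (𝓡 4) (𝓡 2) f q); let G : (Metric.sphere (0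 : EuclideanSpace ℝ (Fin 3)) 1) → ℕ → Prop := fun y n => Nonempty ((Fin (2 * n) → ℤ) ≃ₗ[ℤ] Literature.AlgebraicTopology.SingularHomology.singularHomology ℤ ℤ ↥(f ⁻¹' {y}) 1); ContMDiff (𝓡 4) (𝓡 2) ((⊤ : ℕ∞) : WithTop ℕ∞) f ∧ Function.Surjective f ∧ (∀ p ∈ L, Literature.Topology.FourManifolds.IsLefschetzCriticalPoint (𝓡 4) (𝓡 2) o f p true) ∧ (∀ p : M, ¬ R p → p ∉ L → ∃ (φ : OpenPartialHomeomorph M (EuclideanSpace ℝ (Fin 4))) (ψ : OpenPartialHomeomorph (Metric.sphere (0 : EuclideanSpace ℝ (Fin 3)) 1) (EuclideanSpace ℝ (Fin 2))), p ∈ φ.source ∧ φ p = 0 ∧ Set.MapsTo f φ.source ψ.source ∧ ContMDiffOn (𝓡 4) (𝓡 4) ((⊤ : ℕ∞) : WithTop ℕ∞) φ φ.source ∧ ContMDiffOn (𝓡 4) (𝓡 4) ((⊤ : ℕ∞) : WithTop ℕ∞) φ.symm φ.target ∧ ContMDiffOn (𝓡 2) (𝓡 2) ((⊤ : ℕ∞)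 : WithTop ℕ∞) ψ ψ.source ∧ ContMDiffOn (𝓡 2) (𝓡 2) ((⊤ : ℕ∞) : WithTop ℕ∞) ψ.symm ψ.target ∧ ∀ q ∈ φ.source, (ψ (f q)) 0 = (φ q) 0 ∧ (ψ (f q)) 1 = (φ q) 1 ^ 2 + (φ q) 2 ^ 2 - (φ q) 3 ^ 2) ∧ IsConnected ({p : M | ¬ R p} \ (↑L : Set M)) ∧ Set.InjOn f {p : M | ¬ R p} ∧ (∀ y, (∀ q, f q = y → R q) → IsConnected (f ⁻¹' {y}) ∧ (G y ((h + 1) + 1) ∨ G y ((h + 1)))) ∧ (∃ y, (∀ q, f q = y → R q) ∧ G y ((h + 1) + 1)) ∧ (∃ y, (∀ q, f q = y → R q) ∧ G y ((h + 1))) ∧ (∀ p ∈ L, ∀ᶠ y in nhds (f p), (∀ q, f q = y → R q) → G y ((h + 1) + 1))) → (∃ (o : Literature.Topology.FourManifolds.SmoothOrientation (𝓡 4) M) (f : M → (Metric.sphere (0 : EuclideanSpace ℝ (Fin 3)) 1)) (L : Finset M), let R : M → Prop := fun q => Function.Surjective (mfderiv (𝓡 4) (𝓡 2) f q); let G : (Metric.sphere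 (0 : EuclideanSpace ℝ (Fin 3)) 1) → ℕ → Prop := fun y n => Nonempty ((Fin (2 * n) → ℤ) ≃ₗ[ℤ] Literature.AlgebraicTopology.SingularHomology.singularHomology ℤ ℤ ↥(f ⁻¹' {y}) 1); ContMDiff (𝓡 4) (𝓡 2) ((⊤ : ℕ∞) : WithTop ℕ∞) f ∧ Function.Surjective f ∧ (∀ p ∈ L, Literature.Topology.FourManifolds.IsLefschetzCriticalPoint (𝓡 4) (𝓡 2) o f p true) ∧ (∀ p : M, ¬ R p → p ∉ L → ∃ (φ : OpenPartialHomeomorph M (EuclideanSpace ℝ (Fin 4))) (ψ : OpenPartialHomeomorph (Metric.sphere (0 : EuclideanSpace ℝ (Fin 3)) 1) (EuclideanSpace ℝ (Fin 2))), p ∈ φ.source ∧ φ p = 0 ∧ Set.MapsTo f φ.source ψ.source ∧ ContMDiffOn (𝓡 4) (𝓡 4) ((⊤ : ℕ∞) : WithTop ℕ∞) φ φ.source ∧ ContMDiffOn (𝓡 4) (𝓡 4) ((⊤ : ℕ∞) : WithTop ℕ∞) φ.symm φ.target ∧ ContMDiffOn (𝓡 2) (𝓡 2) ((⊤ : ℕ∞)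 : WithTop ℕ∞) ψ ψ.source ∧ ContMDiffOn (𝓡 2) (𝓡 2) ((⊤ : ℕ∞) : WithTop ℕ∞) ψ.symm ψ.target ∧ ∀ q ∈ φ.source, (ψ (f q)) 0 = (φ q) 0 ∧ (ψ (f q)) 1 = (φ q) 1 ^ 2 + (φ q) 2 ^ 2 - (φ q) 3 ^ 2) ∧ IsConnected ({p : M | ¬ R p} \ (↑L : Set M)) ∧ Set.InjOn f {p : M | ¬ R p} ∧ (∀ y, (∀ q, f q = y → R q) → IsConnected (f ⁻¹' {y}) ∧ (G y (h + 1) ∨ G y (h))) ∧ (∃ y, (∀ q, f q = y → R q) ∧ G y (h + 1)) ∧ (∃ y, (∀ q, f q = y → R q) ∧ G y (h)) ∧ (∀ p ∈ L, ∀ᶠ y in nhds (f p), (∀ q, f q = y → R q) → G y (h + 1)))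

/-- item stmt-SmoothPoincare4-18529 · crux · rank 3 · open · by planner
why it might fail: shielded; a genus-2 Hurwitz system of an exotic sphere would be ¬SPC4; the B₆ enumeration may be infinite up to Hurwitz equivalence and Stab(c)-conjugation, or a genus-2 classification in print may make the rung known (then variant, start at genus 3).
sources: arXiv:1012.4049, arXiv:1010.5814, arXiv:1410.5531, arXiv:1203.4299
[crux] the finite rung — for every smooth M ≃ₕ S⁴, a simplified broken Lefschetz fibration of lower
genus 1 (genus 2, exactly four Lefschetz points, some vanishing cycle meeting the round curve by
MEETS(2)) can be traded for one of lower genus 0 (genus 1); via Birman–Hilden a bounded problem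
about products of four positive half-twists in Map(S², 6 points) (card rung 2). [difficulty: L] -/
@[route_item "route-SmoothPoincare4-SblfDescent", crux]
def StepTwo : Prop :=
  ∀ (M : Type) [TopologicalSpace M] [T2Space M] [SecondCountableTopology M] [ChartedSpace (EuclideanSpace ℝ (Fin 4)) M] [IsManifold (𝓡 4) ((⊤ : ℕ∞) : WithTop ℕ∞) M], M ≃ₕ (Metric.sphere (0 : EuclideanSpace ℝ (Fin 5)) 1) → (∃ (o : Literature.Topology.FourManifolds.SmoothOrientation (𝓡 4) M) (f : M → (Metric.sphere (0 : EuclideanSpace ℝ (Fin 3)) 1)) (L : Finset M), let R : M → Prop := fun q => Function.Surjective (mfderiv (𝓡 4) (𝓡 2) f q); let G : (Metric.sphere (0 : EuclideanSpace ℝ (Fin 3)) 1) → ℕ → Prop := fun y n => Nonempty ((Fin (2 * n) → ℤ) ≃ₗ[ℤ] Literature.AlgebraicTopology.SingularHomology.singularHomology ℤ ℤ ↥(f ⁻¹' {y}) 1); ContMDiff (𝓡 4) (𝓡 2) ((⊤ : ℕ∞) : WithTop ℕ∞) f ∧ Function.Surjective f ∧ (∀ p ∈ L, Literature.Topology.FourManifolds.IsLefschetzCriticalPoint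 (𝓡 4) (𝓡 2) o f p true) ∧ (∀ p : M, ¬ R p → p ∉ L → ∃ (φ : OpenPartialHomeomorph M (EuclideanSpace ℝ (Fin 4))) (ψ : OpenPartialHomeomorph (Metric.sphere (0 : EuclideanSpace ℝ (Fin 3)) 1) (EuclideanSpace ℝ (Fin 2))), p ∈ φ.source ∧ φ p = 0 ∧ Set.MapsTo f φ.source ψ.source ∧ ContMDiffOn (𝓡 4) (𝓡 4) ((⊤ : ℕ∞) : WithTop ℕ∞) φ φ.source ∧ ContMDiffOn (𝓡 4) (𝓡 4) ((⊤ : ℕ∞) : WithTop ℕ∞) φ.symm φ.target ∧ ContMDiffOn (𝓡 2) (𝓡 2) ((⊤ : ℕ∞) : WithTop ℕ∞) ψ ψ.source ∧ ContMDiffOn (𝓡 2) (𝓡 2) ((⊤ : ℕ∞) : WithTop ℕ∞) ψ.symm ψ.target ∧ ∀ q ∈ φ.source, (ψ (f q)) 0 = (φ q) 0 ∧ (ψ (f q)) 1 = (φ q) 1 ^ 2 + (φ q) 2 ^ 2 - (φ q) 3 ^ 2) ∧ IsConnected ({p : M | ¬ R p} \ (↑L : Set M)) ∧ Set.InjOn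 f {p : M | ¬ R p} ∧ (∀ y, (∀ q, f q = y → R q) → IsConnected (f ⁻¹' {y}) ∧ (G y (1 + 1) ∨ G y (1))) ∧ (∃ y, (∀ q, f q = y → R q) ∧ G y (1 + 1)) ∧ (∃ y, (∀ q, f q = y → R q) ∧ G y (1)) ∧ (∀ p ∈ L, ∀ᶠ y in nhds (f p), (∀ q, f q = y → R q) → G y (1 + 1))) → (∃ (o : Literature.Topology.FourManifolds.SmoothOrientation (𝓡 4) M) (f : M → (Metric.sphere (0 : EuclideanSpace ℝ (Fin 3)) 1)) (L : Finset M), let R : M → Prop := fun q => Function.Surjective (mfderiv (𝓡 4) (𝓡 2) f q); let G : (Metric.sphere (0 : EuclideanSpace ℝ (Fin 3)) 1) → ℕ → Prop := fun y n => Nonempty ((Fin (2 * n) → ℤ) ≃ₗ[ℤ] Literature.AlgebraicTopology.SingularHomology.singularHomology ℤ ℤ ↥(f ⁻¹' {y}) 1); ContMDiff (𝓡 4) (𝓡 2) ((⊤ : ℕ∞) : WithTop ℕ∞) f ∧ Function.Surjective f ∧ (∀ p ∈ L, Literature.Topology.FourManifolds.IsLefschetzCriticalPoint (𝓡 4) (𝓡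 2) o f p true) ∧ (∀ p : M, ¬ R p → p ∉ L → ∃ (φ : OpenPartialHomeomorph M (EuclideanSpace ℝ (Fin 4))) (ψ : OpenPartialHomeomorph (Metric.sphere (0 : EuclideanSpace ℝ (Fin 3)) 1) (EuclideanSpace ℝ (Fin 2))), p ∈ φ.source ∧ φ p = 0 ∧ Set.MapsTo f φ.source ψ.source ∧ ContMDiffOn (𝓡 4) (𝓡 4) ((⊤ : ℕ∞) : WithTop ℕ∞) φ φ.source ∧ ContMDiffOn (𝓡 4) (𝓡 4) ((⊤ : ℕ∞) : WithTop ℕ∞) φ.symm φ.target ∧ ContMDiffOn (𝓡 2) (𝓡 2) ((⊤ : ℕ∞) : WithTop ℕ∞) ψ ψ.source ∧ ContMDiffOn (𝓡 2) (𝓡 2) ((⊤ : ℕ∞) : WithTop ℕ∞) ψ.symm ψ.target ∧ ∀ q ∈ φ.source, (ψ (f q)) 0 = (φ q) 0 ∧ (ψ (f q)) 1 = (φ q) 1 ^ 2 + (φ q) 2 ^ 2 - (φ q) 3 ^ 2) ∧ IsConnected ({p : M | ¬ R p} \ (↑L : Set M)) ∧ Set.InjOn f {p : M | ¬ R p} ∧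 (∀ y, (∀ q, f q = y → R q) → IsConnected (f ⁻¹' {y}) ∧ (G y (0 + 1) ∨ G y (0))) ∧ (∃ y, (∀ q, f q = y → R q) ∧ G y (0 + 1)) ∧ (∃ y, (∀ q, f q = y → R q) ∧ G y (0)) ∧ (∀ p ∈ L, ∀ᶠ y in nhds (f p), (∀ q, f q = y → R q) → G y (0 + 1)))

/-- item stmt-SmoothPoincare4-18531 · crux · rank 9 · open · by planner
why it might fail: KNOWN in print (Hayano2011 Cor 4.11 / Main Thm B at r=0; BaykurKamada2015 L11+C14; Baykur2012 L7): cannot fail mathematically. Risk formal, apex-XL: RungOne = EulerCount (M/L, facts seat) + Lefschetz-free genus-1 classification B, whose printed proofs all end in LP72/Gluck or Cerf S⁴-recognition.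
sources: Hayano2011, BaykurKamada2015, Baykur2012, AurouxDonaldsonKatzarkov2005, arXiv:1012.4049, arXiv:1010.5814
[support] the genus-1 rung — a smooth M ≃ₕ S⁴ with a simplified broken Lefschetz fibration of lower
genus 0 (genus 1, round locus non-empty) is diffeomorphic to S⁴ (Hayano's and Baykur–Kamada's
classification of genus-1 SBLFs: total spaces S⁴, #CP²'s and CP²bar's, S¹×S³ # …, Pao's L_n, L′_n;
the only homotopy sphere is S⁴, Baykur arXiv:1205.5439 p.18). Published theorem; long formalisation.
[difficulty: XL] -/
@[route_item "route-SmoothPoincare4-SblfDescent", crux]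
def RungOne : Prop :=
  ∀ (M : Type) [TopologicalSpace M] [T2Space M] [SecondCountableTopology M] [ChartedSpace (EuclideanSpace ℝ (Fin 4)) M] [IsManifold (𝓡 4) ((⊤ : ℕ∞) : WithTop ℕ∞) M], M ≃ₕ (Metric.sphere (0 : EuclideanSpace ℝ (Fin 5)) 1) → (∃ (o : Literature.Topology.FourManifolds.SmoothOrientation (𝓡 4) M) (f : M → (Metric.sphere (0 : EuclideanSpace ℝ (Fin 3)) 1)) (L : Finset M), let R : M → Prop := fun q => Function.Surjective (mfderiv (𝓡 4) (𝓡 2) f q); let G : (Metric.sphere (0 : EuclideanSpace ℝ (Fin 3)) 1) → ℕ → Prop := fun y n => Nonempty ((Fin (2 * n) → ℤ) ≃ₗ[ℤ] Literature.AlgebraicTopology.SingularHomology.singularHomology ℤ ℤ ↥(f ⁻¹' {y}) 1); ContMDiff (𝓡 4) (𝓡 2) ((⊤ : ℕ∞) : WithTop ℕ∞) f ∧ Function.Surjective f ∧ (∀ p ∈ L, Literature.Topology.FourManifolds.IsLefschetzCriticalPoint (𝓡 4) (𝓡 2) o f p true) ∧ (∀ p : M, ¬ R p → p ∉ L → ∃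 (φ : OpenPartialHomeomorph M (EuclideanSpace ℝ (Fin 4))) (ψ : OpenPartialHomeomorph (Metric.sphere (0 : EuclideanSpace ℝ (Fin 3)) 1) (EuclideanSpace ℝ (Fin 2))), p ∈ φ.source ∧ φ p = 0 ∧ Set.MapsTo f φ.source ψ.source ∧ ContMDiffOn (𝓡 4) (𝓡 4) ((⊤ : ℕ∞) : WithTop ℕ∞) φ φ.source ∧ ContMDiffOn (𝓡 4) (𝓡 4) ((⊤ : ℕ∞) : WithTop ℕ∞) φ.symm φ.target ∧ ContMDiffOn (𝓡 2) (𝓡 2) ((⊤ : ℕ∞) : WithTop ℕ∞) ψ ψ.source ∧ ContMDiffOn (𝓡 2) (𝓡 2) ((⊤ : ℕ∞) : WithTop ℕ∞) ψ.symm ψ.target ∧ ∀ q ∈ φ.source, (ψ (f q)) 0 = (φ q) 0 ∧ (ψ (f q)) 1 = (φ q) 1 ^ 2 + (φ q) 2 ^ 2 - (φ q) 3 ^ 2) ∧ IsConnected ({p : M | ¬ R p} \ (↑L : Set M)) ∧ Set.InjOn f {p : M | ¬ R p} ∧ (∀ y, (∀ q, f q = y → R q) → IsConnected (f ⁻¹'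 {y}) ∧ (G y (0 + 1) ∨ G y (0))) ∧ (∃ y, (∀ q, f q = y → R q) ∧ G y (0 + 1)) ∧ (∃ y, (∀ q, f q = y → R q) ∧ G y (0)) ∧ (∀ p ∈ L, ∀ᶠ y in nhds (f p), (∀ q, f q = y → R q) → G y (0 + 1))) → Nonempty (Diffeomorph (𝓡 4) (𝓡 4) M (Metric.sphere (0 : EuclideanSpace ℝ (Fin 5)) 1) ((⊤ : ℕ∞) : WithTop ℕ∞))

/-- item stmt-SmoothPoincare4-18530 · support · rank 9 · open · by planner
sources: arXiv:0801.3139, arXiv:0712.2202, arXiv:0803.2297, arXiv:1705.11169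
[support] every smooth M ≃ₕ S⁴ admits a simplified broken Lefschetz fibration with non-empty round
locus, of some lower genus h (existence of SBLFs on all closed oriented 4-manifolds: Baykur 2008,
Lekili, Akbulut–Karakurt, Williams, Baykur–Saeki; an honest Lefschetz fibration over S² has b₂ ≥ 1,
so on a homotopy sphere the round locus is non-empty). Published theorems; long formalisation.
[difficulty: XL] -/
@[route_item "route-SmoothPoincare4-SblfDescent", crux]
def SblfExists : Prop :=
  ∀ (M : Type) [TopologicalSpace M] [T2Space M] [SecondCountableTopology M] [ChartedSpace (EuclideanSpace ℝ (Fin 4)) M] [IsManifold (𝓡 4) ((⊤ : ℕ∞) : WithTop ℕ∞) M], M ≃ₕ (Metric.sphere (0 : EuclideanSpace ℝ (Fin 5)) 1) → ∃ h : ℕ, (∃ (o : Literature.Topology.FourManifolds.SmoothOrientation (𝓡 4) M) (f : M → (Metric.sphere (0 : EuclideanSpace ℝ (Fin 3)) 1)) (L : Finset M), let R : M → Prop := fun q => Function.Surjective (mfderiv (𝓡 4) (𝓡 2) f q); let G : (Metric.sphere (0 : EuclideanSpace ℝ (Fin 3)) 1) → ℕ → Prop := fun y n => Nonempty ((Fin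 (2 * n) → ℤ) ≃ₗ[ℤ] Literature.AlgebraicTopology.SingularHomology.singularHomology ℤ ℤ ↥(f ⁻¹' {y}) 1); ContMDiff (𝓡 4) (𝓡 2) ((⊤ : ℕ∞) : WithTop ℕ∞) f ∧ Function.Surjective f ∧ (∀ p ∈ L, Literature.Topology.FourManifolds.IsLefschetzCriticalPoint (𝓡 4) (𝓡 2) o f p true) ∧ (∀ p : M, ¬ R p → p ∉ L → ∃ (φ : OpenPartialHomeomorph M (EuclideanSpace ℝ (Fin 4))) (ψ : OpenPartialHomeomorph (Metric.sphere (0 : EuclideanSpace ℝ (Fin 3)) 1) (EuclideanSpace ℝ (Fin 2))), p ∈ φ.source ∧ φ p = 0 ∧ Set.MapsTo f φ.source ψ.source ∧ ContMDiffOn (𝓡 4) (𝓡 4) ((⊤ : ℕ∞) : WithTop ℕ∞) φ φ.source ∧ ContMDiffOn (𝓡 4) (𝓡 4) ((⊤ : ℕ∞) : WithTop ℕ∞) φ.symm φ.target ∧ ContMDiffOn (𝓡 2) (𝓡 2) ((⊤ : ℕ∞) : WithTop ℕ∞) ψ ψ.source ∧ ContMDiffOn (𝓡 2) (𝓡 2)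 ((⊤ : ℕ∞) : WithTop ℕ∞) ψ.symm ψ.target ∧ ∀ q ∈ φ.source, (ψ (f q)) 0 = (φ q) 0 ∧ (ψ (f q)) 1 = (φ q) 1 ^ 2 + (φ q) 2 ^ 2 - (φ q) 3 ^ 2) ∧ IsConnected ({p : M | ¬ R p} \ (↑L : Set M)) ∧ Set.InjOn f {p : M | ¬ R p} ∧ (∀ y, (∀ q, f q = y → R q) → IsConnected (f ⁻¹' {y}) ∧ (G y (h + 1) ∨ G y (h))) ∧ (∃ y, (∀ q, f q = y → R q) ∧ G y (h + 1)) ∧ (∃ y, (∀ q, f q = y → R q) ∧ G y (h)) ∧ (∀ p ∈ L, ∀ᶠ y in nhds (f p), (∀ q, f q = y → R q) → G y (h + 1)))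

-- item stmt-SmoothPoincare4-18554 · support · rank 9 · open · by planner — informal only, no Lean statement yet:
--   [support] Lemma MEETS (planner, 2026-08-17; dossier CANDIDATE-SblfDescent.md §D): if (c;
--   c₁,…,c_{4g−4}) is the Hurwitz cycle system of a simplified broken Lefschetz fibration of genus g ≥ 2
--   on a homotopy 4-sphere X, then some vanishing cycle c_i meets the round curve c essentially. Proof
--   sketch: if all c_i ⊂ Σ_g ∖ c, Baykur s handle decomposition gives π₁(X) = (π₁(Y) ∗ ℤ)/⟨⟨w⟩⟩ with Y
--   the CAPPED genus-(g−1) Lefschetz fibration over S² (cycles c̄_i, relatively minimal by a b₂-count);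
--   H₁(X)=0 forces H₁(Y)=0, χ(Y)=4, b₂(Y)=2, σ(Y)=0, and the Ozbagci–Cadavid bound σ ≤ n−s−2(2(g−1)−b₁)
--   forces s=0.

/-- item stmt-SmoothPoincare4-18532 · assembly · rank 1 · closed · proved by Summit.SmoothPoincare4.SmoothPoincare4.Theorems.sblfDescent_assembly_proof @ 415767276024 (prover) · by planner
sources: arXiv:1205.5439, arXiv:1410.5531
[assembly] SblfExists → RungOne → StepTwo → StepGE3 → SmoothPoincare4 (induction on the lower
genus). -/
@[route_item "route-SmoothPoincare4-SblfDescent"]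
def Assembly : Prop :=
  SblfExists → RungOne → StepTwo → StepGE3 → _root_.SmoothPoincare4

-- `Assembly` holds: proved by `Summit.SmoothPoincare4.SmoothPoincare4.Theorems.sblfDescent_assembly_proof` @ 415767276024 (its module imports this route file, so no `_holds` link can be stated here).

/-! D-0027 §2.1 — DECIDING THEOREM (planner-authored via `route open/edit --closes-file`; by planner-plan-lens3-SmoothPoincare4-strengthen-0 2026-08-17T02:42:15Z):
its hypotheses are this route's items and its conclusion the sub-problem Statement (glue_lint), and it elaborates with this file. -/

@[closes "route-SmoothPoincare4-SblfDescent"] theorem closes (hex : SblfExists) (h1 : RungOne) (h2 : StepTwo) (h3 : StepGE3) :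
    _root_.SmoothPoincare4 := by
  intro M _ _ _ _ _ e
  have key : ∀ h : ℕ, (∃ (o : Literature.Topology.FourManifolds.SmoothOrientation (𝓡 4) M) (f : M → (Metric.sphere (0 : EuclideanSpace ℝ (Fin 3)) 1)) (L : Finset M), let R : M → Prop := fun q => Function.Surjective (mfderiv (𝓡 4) (𝓡 2) f q); let G : (Metric.sphere (0 : EuclideanSpace ℝ (Fin 3)) 1) → ℕ → Prop := fun y n => Nonempty ((Fin (2 * n) → ℤ) ≃ₗ[ℤ] Literature.AlgebraicTopology.SingularHomology.singularHomology ℤ ℤ ↥(f ⁻¹' {y}) 1); ContMDiff (𝓡 4) (𝓡 2) ((⊤ : ℕ∞) : WithTop ℕ∞) f ∧ Function.Surjective f ∧ (∀ p ∈ L, Literature.Topology.FourManifolds.IsLefschetzCriticalPoint (𝓡 4) (𝓡 2) o f p true) ∧ (∀ p : M, ¬ R p → p ∉ L → ∃ (φ : OpenPartialHomeomorph M (EuclideanSpace ℝ (Fin 4))) (ψ : OpenPartialHomeomorph (Metric.sphere (0 : EuclideanSpace ℝ (Fin 3)) 1) (EuclideanSpace ℝ (Fin 2))), p ∈ φ.source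 ∧ φ p = 0 ∧ Set.MapsTo f φ.source ψ.source ∧ ContMDiffOn (𝓡 4) (𝓡 4) ((⊤ : ℕ∞) : WithTop ℕ∞) φ φ.source ∧ ContMDiffOn (𝓡 4) (𝓡 4) ((⊤ : ℕ∞) : WithTop ℕ∞) φ.symm φ.target ∧ ContMDiffOn (𝓡 2) (𝓡 2) ((⊤ : ℕ∞) : WithTop ℕ∞) ψ ψ.source ∧ ContMDiffOn (𝓡 2) (𝓡 2) ((⊤ : ℕ∞) : WithTop ℕ∞) ψ.symm ψ.target ∧ ∀ q ∈ φ.source, (ψ (f q)) 0 = (φ q) 0 ∧ (ψ (f q)) 1 = (φ q) 1 ^ 2 + (φ q) 2 ^ 2 - (φ q) 3 ^ 2) ∧ IsConnected ({p : M | ¬ R p} \ (↑L : Set M)) ∧ Set.InjOn f {p : M | ¬ R p} ∧ (∀ y, (∀ q, f q = y → R q) → IsConnected (f ⁻¹' {y}) ∧ (G y (h + 1) ∨ G y (h))) ∧ (∃ y, (∀ q, f q = y → R q) ∧ G y (h + 1)) ∧ (∃ y, (∀ q, f q = y → R q) ∧ G y (h)) ∧ (∀ p ∈ L, ∀ᶠ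 y in nhds (f p), (∀ q, f q = y → R q) → G y (h + 1))) → Nonempty (Diffeomorph (𝓡 4) (𝓡 4) M (Metric.sphere (0 : EuclideanSpace ℝ (Fin 5)) 1) ((⊤ : ℕ∞) : WithTop ℕ∞)) := by
    intro h
    induction h with
    | zero => intro hh; exact h1 M e hh
    | succ h ih =>
      intro hh
      cases h with
      | zero => exact ih (h2 M e hh)
      | succ h => exact ih (h3 M e (h + 1) (Nat.succ_le_succ (Nat.zero_le h)) hh)
  obtain ⟨h, hh⟩ := hex M e
  exact key h hh

end Summit.SmoothPoincare4.SmoothPoincare4.Theses.SblfDescent
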